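import Literature.Topology.FourManifolds.CellTriangulation
import Literature.Topology.FourManifolds.WhiteheadStage
import Literature.Analysis.Convexity.StandardExtension
import Literature.Analysis.Convexity.ComplexUnion
import HarnessLib

/-!
# Uniqueness of Whitehead-compatible PL structures: the two sheets of a stage

Towards `Literature.Topology.FourManifolds.nonempty_plHomeomorph_of_isWhiteheadCompatible`
(Munkres (1966), Thm 10.5).  One stage of the uniqueness induction straightens two homeomorphisms
`F, G` of `M` simultaneously in one smooth chart `ψ`; this file constructs the two finite
simplicial complexes ("sheets") parametrising `F` and `G` near the stage region, in the
coordinates of a chart `e₁` of the first PL structure and a chart `e₂` of the second: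

* smooth immersive models (`PDModel`) of `ψ ∘ F ∘ e₁.symm`, resp. `ψ ∘ G ∘ e₂.symm`, on every
  simplex (from `IsPDOn`, i.e. from `PDAlong`, via `CellTriangulation.exists_complex_of_local`);
* a down-closed family `Sh` of *shared* simplices of the second sheet on which the comparison map
  `λ = e₁ ∘ F⁻¹ ∘ G ∘ e₂.symm` (PL where `F⁻¹ ∘ G` is already PL) is affine, mapping them onto
  simplices of the first sheet (Munkres' "intersect in a subcomplex", 10.1): obtained by refining
  the second sheet where `λ` is PL, transporting (`ComplexTransport`), refining the first sheet
  adapted to the transported cells (`exists_adapted_refinement`), pulling back and extending by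
  the standard extension (`StandardExtension`, Munkres 7.11–7.12);
* every simplex of either sheet whose image in `M` meets the prescribed compact set `Zc` is
  shared (this is where the two bends of the stage will agree).

No named facts are introduced (`PDModel`, `AffModel` are `Prop`-valued bookkeeping structures).

## References

* J.R. Munkres, *Elementary differential topology*, Ann. of Math. Studies 54 (1963; rev. 1966),
  §10, 10.1–10.2 and Thm 10.5. [Munkres1966]
-/

open Set Function Metric
open scoped Topology ContDiff

noncomputable section

namespace Literature.Topology.FourManifolds

open Literature.Analysis.Convexity

local notation "𝔼 " n:arg => EuclideanSpace ℝ (Fin n)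

/-! ### Models on simplices -/

section Models

variable {n : ℕ}

/-- **A smooth immersive model** of `φ` on the closed simplex of `s`: a globally `C^∞` map
agreeing with `φ` there, with injective derivative at its points (the simplexwise datum of
`IsPDOn`). (A `Prop`-valued bookkeeping structure, not a named fact.) [cite: Munkres1966, 8.3] -/
structure PDModel (φ : 𝔼 n → 𝔼 n) (s : Finset (𝔼 n)) : Prop where
  /-- the model -/
  out : ∃ g : 𝔼 n → 𝔼 n, ContDiff ℝ ∞ g ∧ EqOn φ g (convexHull ℝ (s : Set (𝔼 n))) ∧
    ∀ x ∈ convexHull ℝ (s : Set (𝔼 n)), Injective (fderiv ℝ g x)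

/-- **An affine model** of `φ` on the closed simplex of `s`. (A `Prop`-valued bookkeeping
structure, not a named fact.) [folklore] -/
structure AffModel (φ : 𝔼 n → 𝔼 n) (s : Finset (𝔼 n)) : Prop where
  /-- the model -/
  out : ∃ A : 𝔼 n →ᵃ[ℝ] 𝔼 n, EqOn φ A (convexHull ℝ (s : Set (𝔼 n)))

/-- Models restrict to simplices with smaller closed simplex. [folklore] -/
theorem PDModel.anti {φ : 𝔼 n → 𝔼 n} {s t : Finset (𝔼 n)} (h : PDModel φ s)
    (hts : convexHull ℝ (t : Set (𝔼 n)) ⊆ convexHull ℝ (s : Set (𝔼 n))) : PDModel φ t := by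
  obtain ⟨g, hg, hφg, hinj⟩ := h.out
  exact ⟨g, hg, hφg.mono hts, fun x hx => hinj x (hts hx)⟩

/-- Affine models restrict to simplices with smaller closed simplex. [folklore] -/
theorem AffModel.anti {φ : 𝔼 n → 𝔼 n} {s t : Finset (𝔼 n)} (h : AffModel φ s)
    (hts : convexHull ℝ (t : Set (𝔼 n)) ⊆ convexHull ℝ (s : Set (𝔼 n))) : AffModel φ t := by
  obtain ⟨A, hA⟩ := h.out
  exact ⟨A, hA.mono hts⟩

/-- Local complexes with smooth immersive models, from `IsPDOn`. [folklore] -/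
theorem exists_local_of_isPDOn {φ : 𝔼 n → 𝔼 n} {U : Set (𝔼 n)} (hφ : IsPDOn n φ U) {a : 𝔼 n}
    (ha : a ∈ U) : ∃ K : Geometry.SimplicialComplex ℝ (𝔼 n), K.faces.Finite ∧ K.space ∈ 𝓝 a ∧
      K.space ⊆ U ∧ ∀ s ∈ K.faces, PDModel φ s := by
  obtain ⟨K, hfin, hKa, hKU, hK⟩ := hφ a ha
  exact ⟨K, hfin, hKa, hKU, fun s hs => ⟨hK s hs⟩⟩

/-- Local complexes with affine models, from `IsPLOn`. [folklore] -/
theorem exists_local_of_isPLOn {φ : 𝔼 n → 𝔼 n} {U : Set (𝔼 n)} (hφ : IsPLOn n n φ U) {a : 𝔼 n}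
    (ha : a ∈ U) : ∃ K : Geometry.SimplicialComplex ℝ (𝔼 n), K.faces.Finite ∧ K.space ∈ 𝓝 a ∧
      K.space ⊆ U ∧ ∀ s ∈ K.faces, AffModel φ s := by
  obtain ⟨K, hfin, hKa, hKU, hK⟩ := hφ a ha
  exact ⟨K, hfin, hKa, hKU, fun s hs => ⟨hK s hs⟩⟩

/-- **Combined local complexes.** At a point where `φ` is PD and `μ` is PL there is one finite
complex neighbourhood on whose simplices `φ` has smooth immersive models and `μ` is affine (a
common refinement of the two local complexes inside a small simplex,
`exists_cellTriangulation`). [cite: Munkres1966, 10.2] -/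
theorem exists_local_pd_aff {φ μ : 𝔼 n → 𝔼 n} {U V : Set (𝔼 n)} (hφ : IsPDOn n φ U)
    (hμ : IsPLOn n n μ V) {a : 𝔼 n} (haU : a ∈ U) (haV : a ∈ V) :
    ∃ K : Geometry.SimplicialComplex ℝ (𝔼 n), K.faces.Finite ∧ K.space ∈ 𝓝 a ∧
      K.space ⊆ U ∩ V ∧ ∀ s ∈ K.faces, PDModel φ s ∧ AffModel μ s := by
  classical
  obtain ⟨K₁, h₁fin, h₁a, h₁U, h₁⟩ := exists_local_of_isPDOn hφ haU
  obtain ⟨K₂, h₂fin, h₂a, h₂V, h₂⟩ := exists_local_of_isPLOn hμ haV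
  obtain ⟨D, hDind, -, hDa, hDsub⟩ := exists_affineIndependent_convexHull_subset
    (Filter.inter_mem h₁a h₂a)
  set S : Finset (Finset (𝔼 n)) := insert D (h₁fin.toFinset ∪ h₂fin.toFinset) with hS
  have hmemS : ∀ s, s ∈ S ↔ s = D ∨ s ∈ K₁.faces ∨ s ∈ K₂.faces := fun s => by
    rw [hS, Finset.mem_insert, Finset.mem_union, Set.Finite.mem_toFinset, Set.Finite.mem_toFinset]
  have hSind : ∀ s ∈ S, AffineIndependent ℝ ((↑) : s → 𝔼 n) := fun s hs => by
    rcases (hmemS s).1 hs with rfl | h | h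
    · exact hDind
    · exact K₁.indep h
    · exact K₂.indep h
  obtain ⟨P, hPfin, hPspace, -, hPvert⟩ := exists_cellTriangulation S hSind {D}
    (Finset.singleton_subset_iff.2 ((hmemS D).2 (Or.inl rfl))) (fun _ : Fin 0 => (0 : 𝔼 n →ᵃ[ℝ] ℝ))
  have hspace : P.space = convexHull ℝ (D : Set (𝔼 n)) := by
    rw [hPspace]; simp
  refine ⟨P, hPfin, by rw [hspace]; exact hDa, ?_, fun t ht => ?_⟩
  · rw [hspace]
    exact fun x hx => ⟨h₁U (hDsub hx).1, h₂V (hDsub hx).2⟩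
  · obtain ⟨x, hxt, ⟨D', hD', htD'⟩, hxS, -⟩ := hPvert t ht
    rw [Finset.mem_singleton] at hD'
    subst hD'
    have hxD : x ∈ convexHull ℝ (D' : Set (𝔼 n)) := htD' (subset_convexHull ℝ _ hxt)
    obtain ⟨u₁, hu₁, hxu₁⟩ := Geometry.SimplicialComplex.mem_space_iff.1 (hDsub hxD).1
    obtain ⟨u₂, hu₂, hxu₂⟩ := Geometry.SimplicialComplex.mem_space_iff.1 (hDsub hxD).2
    exact ⟨(h₁ u₁ hu₁).anti (hxS u₁ ((hmemS u₁).2 (Or.inr (Or.inl hu₁))) hxu₁),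
      (h₂ u₂ hu₂).anti (hxS u₂ ((hmemS u₂).2 (Or.inr (Or.inr hu₂))) hxu₂)⟩

end Models

/-! ### Adapted refinements with covering of the extra cells -/

section Refine

variable {E : Type*} [NormedAddCommGroup E] [NormedSpace ℝ E] [FiniteDimensional ℝ E]

/-- `CellTriangulation.exists_adapted_refinement` with the simplexwise covering of the closed
simplices of the extra configurations `S'` lying in the underlying space. [cite: Munkres1966,
Lemma 7.10] -/
theorem exists_adapted_refinement' (K : Geometry.SimplicialComplex ℝ E) (hK : K.faces.Finite)
    (S' : Finset (Finset E)) (hS' : ∀ s ∈ S', AffineIndependent ℝ ((↑) : s → E))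
    {ι₀ : Type*} [Fintype ι₀] (L₀ : ι₀ → E →ᵃ[ℝ] ℝ) :
    ∃ P : Geometry.SimplicialComplex ℝ E, P.faces.Finite ∧ P.space = K.space ∧
      (∀ t ∈ P.faces, ∃ s ∈ K.faces, convexHull ℝ (t : Set E) ⊆ convexHull ℝ (s : Set E)) ∧
      (∀ s, s ∈ K.faces ∨ s ∈ S' → ∀ y ∈ convexHull ℝ (s : Set E), y ∈ K.space → ∃ t ∈ P.faces,
        y ∈ convexHull ℝ (t : Set E) ∧ convexHull ℝ (t : Set E) ⊆ convexHull ℝ (s : Set E)) ∧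
      (∀ t ∈ P.faces, ∃ x ∈ t,
        (∀ s, s ∈ K.faces ∨ s ∈ S' → x ∈ convexHull ℝ (s : Set E) →
          convexHull ℝ (t : Set E) ⊆ convexHull ℝ (s : Set E)) ∧
        (∀ i, ∀ y ∈ convexHull ℝ (t : Set E),
          SignType.sign (L₀ i y) = 0 ∨ SignType.sign (L₀ i y) = SignType.sign (L₀ i x))) := by
  classical
  set S : Finset (Finset E) := hK.toFinset ∪ S' with hS
  have hmemS : ∀ s, s ∈ S ↔ s ∈ K.faces ∨ s ∈ S' := fun s => by
    rw [hS, Finset.mem_union, Set.Finite.mem_toFinset]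
  have hSind : ∀ s ∈ S, AffineIndependent ℝ ((↑) : s → E) := fun s hs => by
    rcases (hmemS s).1 hs with h | h
    · exact K.indep h
    · exact hS' s h
  have h𝒟 : hK.toFinset ⊆ S := Finset.subset_union_left
  obtain ⟨P, hPfin, hPspace, hPcov, hPvert⟩ := exists_cellTriangulation S hSind hK.toFinset h𝒟 L₀
  have hspace : P.space = K.space := by
    rw [hPspace]
    refine Subset.antisymm (fun x hx => ?_) (fun x hx => ?_)
    · obtain ⟨D, hD, hxD⟩ := mem_iUnion₂.1 hx
      exact Geometry.SimplicialComplex.convexHull_subset_space (hK.mem_toFinset.1 hD) hxD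
    · obtain ⟨s, hs, hxs⟩ := Geometry.SimplicialComplex.mem_space_iff.1 hx
      exact mem_iUnion₂.2 ⟨s, hK.mem_toFinset.2 hs, hxs⟩
  refine ⟨P, hPfin, hspace, fun t ht => ?_, fun s hs y hy hyK => ?_, fun t ht => ?_⟩
  · obtain ⟨x, -, ⟨D, hD, htD⟩, -, -⟩ := hPvert t ht
    exact ⟨D, hK.mem_toFinset.1 hD, htD⟩
  · obtain ⟨u, hu, hyu⟩ := Geometry.SimplicialComplex.mem_space_iff.1 hyK
    exact hPcov s ((hmemS s).2 hs) y hy ⟨u, hK.mem_toFinset.2 hu, hyu⟩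
  · obtain ⟨x, hxt, -, hxS, hsign⟩ := hPvert t ht
    exact ⟨x, hxt, fun s hs hxs => hxS s ((hmemS s).2 hs) hxs, hsign⟩

end Refine

/-! ### One sheet: PD models everywhere, affine models near a compact set, fine and adapted -/

section OneSheet

variable {n : ℕ}

/-- **A finite complex adapted to everything a sheet needs.**  Let `φ` be PD on the open set
`U ⊇ C` (`C` compact), `μ` PL on the open set `V`, `CJ` compact with `cthickening (2 r) CJ ⊆ V`
(`r > 0`), `ρ > 0`, and `S'` finitely many affinely independent configurations.  There is a finite
complex `K` with `C ⊆ interior K.space`, `K.space ⊆ U`, smooth immersive models of `φ` on all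
simplices, affine models of `μ` (and `conv s ⊆ V`) on every simplex whose closed simplex meets
`cthickening r CJ`, all closed simplices of diameter `≤ ρ`, and adapted to `S'`: each simplex has
a vertex `x` with `conv t ⊆ conv s` for all `s ∈ S'` whose closed simplex contains `x`, and every
closed simplex of a member of `S'` lying in `K.space` is covered simplexwise.
[cite: Munkres1966, 10.2] -/
theorem exists_complex_adapted {φ μ : 𝔼 n → 𝔼 n} {U V C CJ : Set (𝔼 n)} (hU : IsOpen U)
    (hφ : IsPDOn n φ U) (hμ : IsPLOn n n μ V) (hC : IsCompact C) (hCU : C ⊆ U)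
    {r : ℝ} (hr : 0 < r) (h2r : cthickening (2 * r) CJ ⊆ V) {ρ : ℝ} (hρ : 0 < ρ)
    (S' : Finset (Finset (𝔼 n))) (hS' : ∀ s ∈ S', AffineIndependent ℝ ((↑) : s → 𝔼 n)) :
    ∃ K : Geometry.SimplicialComplex ℝ (𝔼 n), K.faces.Finite ∧ C ⊆ interior K.space ∧
      K.space ⊆ U ∧ (∀ s ∈ K.faces, PDModel φ s) ∧
      (∀ s ∈ K.faces, (convexHull ℝ (s : Set (𝔼 n)) ∩ cthickening r CJ).Nonempty →
        AffModel μ s ∧ convexHull ℝ (s : Set (𝔼 n)) ⊆ V) ∧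
      (∀ t ∈ K.faces, ∀ x ∈ convexHull ℝ (t : Set (𝔼 n)), ∀ y ∈ convexHull ℝ (t : Set (𝔼 n)),
        dist x y ≤ ρ) ∧
      (∀ t ∈ K.faces, ∃ x ∈ t, ∀ s ∈ S', x ∈ convexHull ℝ (s : Set (𝔼 n)) →
        convexHull ℝ (t : Set (𝔼 n)) ⊆ convexHull ℝ (s : Set (𝔼 n))) ∧
      (∀ s ∈ S', convexHull ℝ (s : Set (𝔼 n)) ⊆ K.space → ∀ y ∈ convexHull ℝ (s : Set (𝔼 n)),
        ∃ t ∈ K.faces, y ∈ convexHull ℝ (t : Set (𝔼 n)) ∧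
          convexHull ℝ (t : Set (𝔼 n)) ⊆ convexHull ℝ (s : Set (𝔼 n))) := by
  classical
  -- a bounded open set around `C`
  obtain ⟨R₀, hCR₀⟩ := hC.isBounded.subset_ball (0 : 𝔼 n)
  set R : ℕ := ⌈max R₀ 0⌉₊ with hR
  have hR₀R : R₀ ≤ R := (le_max_left _ _).trans (Nat.le_ceil _)
  set U' : Set (𝔼 n) := U ∩ ball 0 R with hU'
  have hU'o : IsOpen U' := hU.inter isOpen_ball
  have hCU' : C ⊆ U' := fun x hx => ⟨hCU hx, ball_subset_ball hR₀R (hCR₀ hx)⟩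
  -- the hereditary property
  set Good : Finset (𝔼 n) → Prop := fun s => PDModel φ s ∧
    ((convexHull ℝ (s : Set (𝔼 n)) ∩ cthickening r CJ).Nonempty →
      AffModel μ s ∧ convexHull ℝ (s : Set (𝔼 n)) ⊆ V) with hGood
  have hher : ∀ s t : Finset (𝔼 n), convexHull ℝ (t : Set (𝔼 n)) ⊆ convexHull ℝ (s : Set (𝔼 n)) →
      Good s → Good t := fun s t hts hs =>
    ⟨hs.1.anti hts, fun hne => by
      obtain ⟨hA, hsV⟩ := hs.2 (hne.mono (inter_subset_inter_left _ hts))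
      exact ⟨hA.anti hts, hts.trans hsV⟩⟩
  -- local complexes
  have hloc : ∀ a ∈ C, ∃ K : Geometry.SimplicialComplex ℝ (𝔼 n), K.faces.Finite ∧ K.space ∈ 𝓝 a ∧
      K.space ⊆ U' ∧ ∀ s ∈ K.faces, Good s := by
    intro a ha
    by_cases haV : a ∈ V
    · obtain ⟨K, hfin, hKa, hKUV, hK⟩ :=
        exists_local_pd_aff (hφ.mono hU'o inter_subset_left) hμ (hCU' ha) haV
      exact ⟨K, hfin, hKa, fun x hx => (hKUV hx).1, fun s hs =>
        ⟨(hK s hs).1, fun _ => ⟨(hK s hs).2,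
          (Geometry.SimplicialComplex.convexHull_subset_space hs).trans fun x hx => (hKUV hx).2⟩⟩⟩
    · -- far from `CJ`: a local complex inside `ball a r` cannot meet `cthickening r CJ`
      have hfar : ∀ x ∈ ball a r, x ∉ cthickening r CJ := by
        intro x hx hxC
        have haC : a ∈ cthickening (2 * r) CJ := by
          rw [mem_cthickening_iff] at hxC ⊢
          have h1 : Metric.infEDist a CJ ≤ Metric.infEDist x CJ + edist a x :=
            Metric.infEDist_le_infEDist_add_edist
          have h2 : edist a x < ENNReal.ofReal r := by
            rw [edist_dist, dist_comm]; exact ENNReal.ofReal_lt_ofReal_iff hr |>.2 (mem_ball.1 hx)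
          calc Metric.infEDist a CJ ≤ ENNReal.ofReal r + ENNReal.ofReal r := by
                exact h1.trans (add_le_add hxC h2.le)
            _ = ENNReal.ofReal (2 * r) := by rw [← ENNReal.ofReal_add hr.le hr.le, two_mul]
        exact haV (h2r haC)
      obtain ⟨K, hfin, hKa, hKU', hK⟩ := exists_local_of_isPDOn
        (hφ.mono (hU'o.inter isOpen_ball) (inter_subset_left.trans inter_subset_left))
        ⟨hCU' ha, mem_ball_self hr⟩
      refine ⟨K, hfin, hKa, fun x hx => (hKU' hx).1, fun s hs => ⟨hK s hs, fun hne => ?_⟩⟩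
      obtain ⟨x, hxs, hxC⟩ := hne
      exact (hfar x (hKU' (Geometry.SimplicialComplex.convexHull_subset_space hs hxs)).2 hxC).elim
  obtain ⟨K₀, hK₀fin, hCK₀, hK₀U', hK₀good, -⟩ :=
    exists_complex_of_local hher hC hloc (fun _ : Fin 0 => (0 : 𝔼 n →ᵃ[ℝ] ℝ))
  -- the mesh: `√n / m ≤ ρ / 2`
  obtain ⟨m, hm⟩ := exists_nat_gt (Real.sqrt n / (ρ / 2))
  have hm0 : 0 < m := by
    have : (0 : ℝ) < m := lt_of_le_of_lt (by positivity) hm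
    exact_mod_cast this
  have hmesh : Real.sqrt n / m ≤ ρ / 2 := by
    have hm' : (0 : ℝ) < m := by exact_mod_cast hm0
    rw [div_le_iff₀ hm']
    rw [div_lt_iff₀ (by positivity : (0 : ℝ) < ρ / 2)] at hm
    linarith [mul_comm (ρ / 2) (m : ℝ)]
  -- refine, adapted to `S'` and the grid
  obtain ⟨K, hKfin, hKspace, hKref, hKcov, hKvert⟩ :=
    exists_adapted_refinement' K₀ hK₀fin S' hS' (gridFun n m R)
  refine ⟨K, hKfin, by rw [hKspace]; exact hCK₀, by rw [hKspace]; exact fun x hx => (hK₀U' hx).1,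
    fun t ht => ?_, fun t ht => ?_, fun t ht x hx y hy => ?_, fun t ht => ?_, fun s hs hsK y hy => ?_⟩
  · obtain ⟨s, hs, hts⟩ := hKref t ht
    exact ((hK₀good s hs).1).anti hts
  · obtain ⟨s, hs, hts⟩ := hKref t ht
    exact (hher s t hts (hK₀good s hs)).2
  · obtain ⟨v, hvt, -, hsign⟩ := hKvert t ht
    have hvK : v ∈ K₀.space := by
      rw [← hKspace]
      exact Geometry.SimplicialComplex.convexHull_subset_space ht (subset_convexHull ℝ _ hvt)
    have hvR : ∀ i, |v i| ≤ R := fun i => by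
      have hv : ‖v‖ < R := by simpa using (hK₀U' hvK).2
      exact ((Real.norm_eq_abs _).symm.le.trans (PiLp.norm_apply_le v i)).trans hv.le
    have hx' := norm_sub_le_of_grid_signs hm0 hvR hsign hx
    have hy' := norm_sub_le_of_grid_signs hm0 hvR hsign hy
    calc dist x y ≤ dist x v + dist v y := dist_triangle _ _ _
      _ ≤ Real.sqrt n / m + Real.sqrt n / m := by
          rw [dist_eq_norm, dist_eq_norm, ← norm_neg (v - y), neg_sub]; exact add_le_add hx' hy'
      _ ≤ ρ / 2 + ρ / 2 := add_le_add hmesh hmesh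
      _ = ρ := by ring
  · obtain ⟨v, hvt, hvS, -⟩ := hKvert t ht
    exact ⟨v, hvt, fun s hs hvs => hvS s (Or.inr hs) hvs⟩
  · exact hKcov s (Or.inr hs) y hy (by rw [← hKspace]; exact hsK hy)

end OneSheet

/-! ### Pulling back a refinement along a simplexwise affine injection -/

section Pullback

variable {E : Type*} [NormedAddCommGroup E] [NormedSpace ℝ E] [FiniteDimensional ℝ E]

/-- **Pull-back and standard extension.**  Let `J₁` be a down-closed family of simplices of the
finite complex `L₁`, `μ` a map injective on `⋃ u ∈ J₁, conv u` with affine models on its members,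
and `K₂` a finite complex covering every cell `μ '' conv u` (`u ∈ J₁`) simplexwise.  Then the
simplices of `K₂` inside the
cells pull back to a complex subdividing `J₁` simplexwise, and the standard extension gives a
finite complex `L₂` with the same underlying space as `L₁`, refining `L₁`, together with the
down-closed family `J₂` of its simplices inside closed simplices of `J₁`: on each of them `μ` is
affine, maps it onto a simplex of `K₂` (with the image of the closed simplex), and every simplex
of `K₂` inside a cell arises this way. [cite: Munkres1966, 7.10–7.12 and 10.2] -/
theorem exists_pullback_extension [DecidableEq E] (L₁ : Geometry.SimplicialComplex ℝ E)
    (hL₁ : L₁.faces.Finite) {J₁ : Set (Finset E)} (hJ₁ : J₁ ⊆ L₁.faces)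
    (hJ₁down : ∀ s ∈ J₁, ∀ t ⊆ s, t.Nonempty → t ∈ J₁) (μ : E → E)
    (hinj : InjOn μ (⋃ u ∈ J₁, convexHull ℝ (u : Set E)))
    (hAff : ∀ u ∈ J₁, ∃ A : E →ᵃ[ℝ] E, EqOn μ A (convexHull ℝ (u : Set E)))
    (K₂ : Geometry.SimplicialComplex ℝ E) (hK₂ : K₂.faces.Finite)
    (hcov : ∀ u ∈ J₁, ∀ z ∈ μ '' convexHull ℝ (u : Set E), ∃ t ∈ K₂.faces,
      z ∈ convexHull ℝ (t : Set E) ∧ convexHull ℝ (t : Set E) ⊆ μ '' convexHull ℝ (u : Set E)) :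
    ∃ L₂ : Geometry.SimplicialComplex ℝ E, ∃ J₂ : Set (Finset E), L₂.faces.Finite ∧
      L₂.space = L₁.space ∧
      (∀ r ∈ L₂.faces, ∃ s ∈ L₁.faces, convexHull ℝ (r : Set E) ⊆ convexHull ℝ (s : Set E)) ∧
      (∀ s ∈ L₁.faces, ∀ y ∈ convexHull ℝ (s : Set E), ∃ r ∈ L₂.faces,
        y ∈ convexHull ℝ (r : Set E) ∧ convexHull ℝ (r : Set E) ⊆ convexHull ℝ (s : Set E)) ∧
      J₂ ⊆ L₂.faces ∧ (∀ r ∈ J₂, ∀ r' ⊆ r, r'.Nonempty → r' ∈ J₂) ∧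
      (∀ r ∈ L₂.faces, (∃ u ∈ J₁, convexHull ℝ (r : Set E) ⊆ convexHull ℝ (u : Set E)) → r ∈ J₂) ∧
      (∀ r ∈ J₂, (∃ u ∈ J₁, convexHull ℝ (r : Set E) ⊆ convexHull ℝ (u : Set E)) ∧
        (∃ A : E →ᵃ[ℝ] E, EqOn μ A (convexHull ℝ (r : Set E))) ∧ r.image μ ∈ K₂.faces ∧
        convexHull ℝ ((r.image μ : Finset E) : Set E) = μ '' convexHull ℝ (r : Set E)) ∧
      (∀ t ∈ K₂.faces, (∃ u ∈ J₁, convexHull ℝ (t : Set E) ⊆ μ '' convexHull ℝ (u : Set E)) →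
        ∃ r ∈ J₂, r.image μ = t) := by
  classical
  -- the cells and the simplices of `K₂` inside them
  set Dom : Set E := ⋃ u ∈ J₁, convexHull ℝ (u : Set E) with hDom
  have hcellDom : ∀ u ∈ J₁, convexHull ℝ (u : Set E) ⊆ Dom := fun u hu x hx =>
    mem_iUnion₂.2 ⟨u, hu, hx⟩
  set KJ : Set (Finset E) := {t | t ∈ K₂.faces ∧
    ∃ u ∈ J₁, convexHull ℝ (t : Set E) ⊆ μ '' convexHull ℝ (u : Set E)} with hKJ
  have hKJsub : KJ ⊆ K₂.faces := fun t ht => ht.1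
  have hKJdown : ∀ t ∈ KJ, ∀ t' ⊆ t, t'.Nonempty → t' ∈ KJ := fun t ht t' htt' hne =>
    ⟨K₂.down_closed ht.1 htt' hne, by
      obtain ⟨u, hu, htu⟩ := ht.2
      exact ⟨u, hu, (convexHull_mono (by exact_mod_cast htt')).trans htu⟩⟩
  set Q : Geometry.SimplicialComplex ℝ E := subcomplexOf K₂ KJ hKJsub hKJdown with hQ
  have hQfaces : Q.faces = KJ := rfl
  -- the inverse `ν` of `μ` on `Dom`
  set ν : E → E := invFunOn μ Dom with hν
  have hνμ : ∀ y ∈ Dom, ν (μ y) = y := fun y hy => hinj.leftInvOn_invFunOn hy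
  have hμν : ∀ z ∈ μ '' Dom, μ (ν z) = z := fun z hz => by
    obtain ⟨y, hy, rfl⟩ := hz
    rw [hνμ y hy]
  have hνimg : ∀ u ∈ J₁, ν '' (μ '' convexHull ℝ (u : Set E)) = convexHull ℝ (u : Set E) := by
    intro u hu
    refine Subset.antisymm ?_ fun y hy => ⟨μ y, ⟨y, hy, rfl⟩, hνμ y (hcellDom u hu hy)⟩
    rintro _ ⟨_, ⟨y, hy, rfl⟩, rfl⟩
    rw [hνμ y (hcellDom u hu hy)]
    exact hy
  -- `ν` is affine on the simplices of `Q` and injective on `Q.space`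
  have hνaff : ∀ t ∈ Q.faces, ∃ B : E →ᵃ[ℝ] E, EqOn ν B (convexHull ℝ (t : Set E)) := by
    intro t ht
    obtain ⟨-, u, hu, htu⟩ := (show t ∈ KJ from ht)
    obtain ⟨A, hA⟩ := hAff u hu
    have hAinj : InjOn A (convexHull ℝ (u : Set E)) := fun y hy y' hy' h =>
      hinj (hcellDom u hu hy) (hcellDom u hu hy') (by rw [hA hy, hA hy']; exact h)
    obtain ⟨B, hB⟩ := exists_affine_leftInv A hAinj
    refine ⟨B, fun z hz => ?_⟩
    obtain ⟨y, hy, rfl⟩ := htu hz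
    rw [hνμ y (hcellDom u hu hy), hA hy, hB y hy]
  have hQDom : Q.space ⊆ μ '' Dom := fun z hz => by
    obtain ⟨t, ht, hzt⟩ := Geometry.SimplicialComplex.mem_space_iff.1 hz
    obtain ⟨-, u, hu, htu⟩ := (show t ∈ KJ from ht)
    exact image_mono (hcellDom u hu) (htu hzt)
  have hνinj : InjOn ν Q.space := fun z hz z' hz' h => by
    have h' := congrArg μ h
    rwa [hμν z (hQDom hz), hμν z' (hQDom hz')] at h'
  -- transport `Q` along `ν`
  obtain ⟨R, hRfaces, hRhull⟩ := exists_simplicialComplex_image Q ν hνaff hνinj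
  have hRfin : R.faces.Finite := by
    have : R.faces = (fun t => t.image ν) '' KJ := by
      ext r
      rw [hRfaces r, Set.mem_image]
      rfl
    rw [this]
    exact (hK₂.subset hKJsub).image _
  have hRa : ∀ r ∈ R.faces, ∃ s ∈ J₁, convexHull ℝ (r : Set E) ⊆ convexHull ℝ (s : Set E) := by
    intro r hr
    obtain ⟨t, ht, rfl⟩ := (hRfaces r).1 hr
    obtain ⟨-, u, hu, htu⟩ := (show t ∈ KJ from ht)
    refine ⟨u, hu, ?_⟩
    rw [hRhull t ht, ← hνimg u hu]
    exact image_mono htu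
  have hRb : ∀ s ∈ J₁, ∀ y ∈ convexHull ℝ (s : Set E), ∃ r ∈ R.faces,
      y ∈ convexHull ℝ (r : Set E) ∧ convexHull ℝ (r : Set E) ⊆ convexHull ℝ (s : Set E) := by
    intro s hs y hy
    obtain ⟨t, ht, hzt, hts⟩ := hcov s hs (μ y) ⟨y, hy, rfl⟩
    have htKJ : t ∈ KJ := ⟨ht, s, hs, hts⟩
    refine ⟨t.image ν, (hRfaces _).2 ⟨t, htKJ, rfl⟩, ?_, ?_⟩
    · rw [hRhull t htKJ]
      exact ⟨μ y, hzt, hνμ y (hcellDom s hs hy)⟩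
    · rw [hRhull t htKJ, ← hνimg s hs]
      exact image_mono hts
  -- the standard extension
  obtain ⟨L₂, hL₂fin, hRL₂, -, hdich, hcovL, -⟩ :=
    exists_standardExtension hL₁ hJ₁ hJ₁down hRfin hRa hRb
  have hrefine : ∀ r ∈ L₂.faces, ∃ s ∈ L₁.faces, convexHull ℝ (r : Set E) ⊆ convexHull ℝ (s : Set E) :=
    fun r hr => by
      rcases hdich r hr with ⟨s, hs, h⟩ | ⟨u, hu, -, h⟩
      · exact ⟨s, hJ₁ hs, h⟩
      · exact ⟨u, hu, h⟩
  refine ⟨L₂, R.faces, hL₂fin, ?_, hrefine, hcovL, hRL₂, fun r hr r' hrr' hne =>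
    R.down_closed hr hrr' hne, fun r hr hru => ?_, fun r hr => ?_, fun t ht htu => ?_⟩
  · -- underlying space
    refine Subset.antisymm (fun x hx => ?_) (fun x hx => ?_)
    · obtain ⟨r, hr, hxr⟩ := Geometry.SimplicialComplex.mem_space_iff.1 hx
      obtain ⟨s, hs, hrs⟩ := hrefine r hr
      exact Geometry.SimplicialComplex.convexHull_subset_space hs (hrs hxr)
    · obtain ⟨s, hs, hxs⟩ := Geometry.SimplicialComplex.mem_space_iff.1 hx
      obtain ⟨r, hr, hxr, -⟩ := hcovL s hs x hxs
      exact Geometry.SimplicialComplex.convexHull_subset_space hr hxr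
  · -- simplices inside a closed simplex of `J₁` are in `J₂`
    obtain ⟨u, hu, hru⟩ := hru
    refine mem_of_convexHull_subset_biUnion hRL₂ (fun ρ hρ ρ' h hne => R.down_closed hρ h hne) hr
      (hru.trans fun y hy => ?_)
    obtain ⟨ρ, hρ, hyρ, -⟩ := hRb u hu y hy
    exact mem_iUnion₂.2 ⟨ρ, hρ, hyρ⟩
  · -- properties of the members of `J₂`
    obtain ⟨t, ht, rfl⟩ := (hRfaces r).1 hr
    obtain ⟨htK, u, hu, htu⟩ := (show t ∈ KJ from ht)
    have hsub : convexHull ℝ ((t.image ν : Finset E) : Set E) ⊆ convexHull ℝ (u : Set E) := by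
      rw [hRhull t ht, ← hνimg u hu]; exact image_mono htu
    have htDom : (t : Set E) ⊆ μ '' Dom := fun z hz =>
      image_mono (hcellDom u hu) (htu (subset_convexHull ℝ _ hz))
    have himg : (t.image ν).image μ = t := by
      rw [Finset.image_image]
      conv_rhs => rw [← Finset.image_id (s := t)]
      exact Finset.image_congr fun z hz => hμν z (htDom hz)
    obtain ⟨A, hA⟩ := hAff u hu
    refine ⟨⟨u, hu, hsub⟩, ⟨A, hA.mono hsub⟩, by rw [himg]; exact htK, ?_⟩
    rw [himg, hRhull t ht]
    refine Subset.antisymm (fun z hz => ⟨ν z, ⟨z, hz, rfl⟩,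
      hμν z (image_mono (hcellDom u hu) (htu hz))⟩) ?_
    rintro _ ⟨_, ⟨z, hz, rfl⟩, rfl⟩
    rw [hμν z (image_mono (hcellDom u hu) (htu hz))]
    exact hz
  · -- every simplex of `K₂` inside a cell arises
    have htKJ : t ∈ KJ := ⟨ht, htu⟩
    obtain ⟨u, hu, htu'⟩ := htu
    refine ⟨t.image ν, (hRfaces _).2 ⟨t, htKJ, rfl⟩, ?_⟩
    rw [Finset.image_image]
    conv_rhs => rw [← Finset.image_id (s := t)]
    exact Finset.image_congr fun z hz =>
      hμν z (image_mono (hcellDom u hu) (htu' (subset_convexHull ℝ _ hz)))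

end Pullback

/-! ### The pure part, with its membership criterion -/

section Pure

variable {E : Type*} [NormedAddCommGroup E] [NormedSpace ℝ E] [FiniteDimensional ℝ E]

/-- `CellTriangulation.exists_pure_subcomplex` together with the membership criterion: a simplex
of `P` with a top-dimensional coface belongs to the pure part; in particular every simplex whose
closed simplex lies in the closure of the interior of `P.space` does
(`ComplexTransport.exists_subset_affineSpan_eq_top`). [folklore] -/
theorem exists_pure_subcomplex' (P : Geometry.SimplicialComplex ℝ E) (hfin : P.faces.Finite) :
    ∃ P' : Geometry.SimplicialComplex ℝ E, P'.faces ⊆ P.faces ∧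
      interior P.space ⊆ P'.space ∧ P'.space ⊆ P.space ∧
      (∀ t ∈ P'.faces, ∃ s ∈ P'.faces, t ⊆ s ∧ s.card = Module.finrank ℝ E + 1) ∧
      (∀ t ∈ P.faces, convexHull ℝ (t : Set E) ⊆ closure (interior P.space) → t ∈ P'.faces) := by
  classical
  set F : Set (Finset E) := {t | t ∈ P.faces ∧ ∃ s ∈ P.faces, t ⊆ s ∧
    s.card = Module.finrank ℝ E + 1} with hF
  have hFP : F ⊆ P.faces := fun t ht => ht.1
  have hdown : ∀ s ∈ F, ∀ t ⊆ s, t.Nonempty → t ∈ F := fun s hs t hts htne =>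
    ⟨P.down_closed hs.1 hts htne, by
      obtain ⟨u, hu, hsu, hcard⟩ := hs.2
      exact ⟨u, hu, hts.trans hsu, hcard⟩⟩
  have hcrit : ∀ t ∈ P.faces, convexHull ℝ (t : Set E) ⊆ closure (interior P.space) → t ∈ F := by
    intro t ht hcl
    obtain ⟨s, hs, hts, htop⟩ := exists_subset_affineSpan_eq_top hfin ht hcl
    have hcard : s.card = Module.finrank ℝ E + 1 := by
      have h := (P.indep hs).affineSpan_eq_top_iff_card_eq_finrank_add_one.1
        (by rwa [Subtype.range_coe])
      rwa [Fintype.card_coe] at h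
    exact ⟨ht, s, hs, hts, hcard⟩
  refine ⟨subcomplexOf P F hFP hdown, hFP, fun x hx => ?_, fun x hx => ?_, fun t ht => ?_, hcrit⟩
  · obtain ⟨s, hs, htop, hxs⟩ := exists_mem_faces_affineSpan_eq_top_of_mem_interior hfin hx
    have hcard : s.card = Module.finrank ℝ E + 1 := by
      have h := (P.indep hs).affineSpan_eq_top_iff_card_eq_finrank_add_one.1
        (by rwa [Subtype.range_coe])
      rwa [Fintype.card_coe] at h
    exact Geometry.SimplicialComplex.mem_space_iff.2 ⟨s, ⟨hs, s, hs, Subset.rfl, hcard⟩, hxs⟩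
  · obtain ⟨s, hs, hxs⟩ := Geometry.SimplicialComplex.mem_space_iff.1 hx
    exact Geometry.SimplicialComplex.mem_space_iff.2 ⟨s, hFP hs, hxs⟩
  · obtain ⟨s, hs, hts, hcard⟩ := (show t ∈ F from ht).2
    exact ⟨s, ⟨hs, s, hs, Subset.rfl, hcard⟩, hts, hcard⟩

end Pure

/-! ### The two sheets of a stage -/

section TwoSheets

variable {n : ℕ} {M : Type*} [TopologicalSpace M]

/-- **The two sheets of a stage.** For a smooth chart `ψ`, a chart `e₁` of the first and `e₂` of
the second PL structure, homeomorphisms `F, G` of `M`, the open set `W` where `F⁻¹ ∘ G` is known to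
be PL, a compact coordinate region `R ⊆ ψ.target` and a compact set `Zc ⊆ M`: finite pure complexes
`K` (in `e₁`-coordinates) and `L` (in `e₂`-coordinates) with smooth immersive models of
`ψ ∘ F ∘ e₁.symm`, resp. `ψ ∘ G ∘ e₂.symm`, covering `ψ.symm '' R` by the interiors of their images,
and a down-closed family `Sh` of simplices of `L` mapped simplexwise affinely by
`λ = e₁ ∘ F⁻¹ ∘ G ∘ e₂.symm` onto simplices of `K`, containing every simplex of `L` whose image meets
`Zc` and hitting every simplex of `K` whose image meets `Zc`. (Bookkeeping structure, not a named
fact.) [cite: Munkres1966, 10.1–10.2] -/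
structure TwoSheets (ψ e₁ e₂ : OpenPartialHomeomorph M (𝔼 n)) (F G : M ≃ₜ M) (W : Set M)
    (R : Set (𝔼 n)) (Zc : Set M) where
  /-- the first sheet -/
  K : Geometry.SimplicialComplex ℝ (𝔼 n)
  /-- the second sheet -/
  L : Geometry.SimplicialComplex ℝ (𝔼 n)
  /-- the shared simplices (of `L`) -/
  Sh : Set (Finset (𝔼 n))
  hKfin : K.faces.Finite
  hLfin : L.faces.Finite
  hKpure : ∀ r ∈ K.faces, ∃ s ∈ K.faces, r ⊆ s ∧ s.card = n + 1
  hLpure : ∀ r ∈ L.faces, ∃ s ∈ L.faces, r ⊆ s ∧ s.card = n + 1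
  hKU : K.space ⊆ e₁.target ∩ e₁.symm ⁻¹' (F ⁻¹' ψ.source)
  hLU : L.space ⊆ e₂.target ∩ e₂.symm ⁻¹' (G ⁻¹' ψ.source)
  hKcov : ψ.symm '' R ⊆ interior (F '' (e₁.symm '' K.space))
  hLcov : ψ.symm '' R ⊆ interior (G '' (e₂.symm '' L.space))
  hKmodel : ∀ s ∈ K.faces, PDModel (ψ ∘ F ∘ e₁.symm) s
  hLmodel : ∀ t ∈ L.faces, PDModel (ψ ∘ G ∘ e₂.symm) t
  hSh : Sh ⊆ L.faces
  hShdown : ∀ t ∈ Sh, ∀ t' ⊆ t, t'.Nonempty → t' ∈ Sh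
  hShV : ∀ t ∈ Sh, convexHull ℝ (t : Set (𝔼 n)) ⊆
    e₂.target ∩ e₂.symm ⁻¹' (W ∩ (F.symm ∘ G) ⁻¹' e₁.source)
  hShaff : ∀ t ∈ Sh, AffModel (e₁ ∘ F.symm ∘ G ∘ e₂.symm) t
  hShimg : ∀ t ∈ Sh, t.image (e₁ ∘ F.symm ∘ G ∘ e₂.symm) ∈ K.faces
  hShhull : ∀ t ∈ Sh, convexHull ℝ ((t.image (e₁ ∘ F.symm ∘ G ∘ e₂.symm) : Finset (𝔼 n)) :
    Set (𝔼 n)) = (e₁ ∘ F.symm ∘ G ∘ e₂.symm) '' convexHull ℝ (t : Set (𝔼 n))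
  hLshare : ∀ t ∈ L.faces, (∃ y ∈ convexHull ℝ (t : Set (𝔼 n)), G (e₂.symm y) ∈ Zc) → t ∈ Sh
  hKshare : ∀ s ∈ K.faces, (∃ x ∈ convexHull ℝ (s : Set (𝔼 n)), F (e₁.symm x) ∈ Zc) →
    ∃ t ∈ Sh, t.image (e₁ ∘ F.symm ∘ G ∘ e₂.symm) = s

/-- The comparison map `λ = e₁ ∘ F⁻¹ ∘ G ∘ e₂.symm` is injective on its natural domain. [folklore] -/
theorem injOn_comparison (e₁ e₂ : OpenPartialHomeomorph M (𝔼 n)) (F G : M ≃ₜ M) (W : Set M) :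
    InjOn (e₁ ∘ F.symm ∘ G ∘ e₂.symm) (e₂.target ∩ e₂.symm ⁻¹' (W ∩ (F.symm ∘ G) ⁻¹' e₁.source)) := by
  intro y hy y' hy' h
  have h1 : F.symm (G (e₂.symm y)) = F.symm (G (e₂.symm y')) := e₁.injOn hy.2.2 hy'.2.2 h
  have h2 : e₂.symm y = e₂.symm y' := G.injective (F.symm.injective h1)
  exact e₂.symm.injOn (by rw [e₂.symm_source]; exact hy.1) (by rw [e₂.symm_source]; exact hy'.1) h2

/-- **The two sheets exist.** [cite: Munkres1966, 10.1–10.2] -/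
theorem exists_twoSheets (ψ e₁ e₂ : OpenPartialHomeomorph M (𝔼 n)) (F G : M ≃ₜ M)
    (hF : IsPDOn n (ψ ∘ F ∘ e₁.symm) (e₁.target ∩ e₁.symm ⁻¹' (F ⁻¹' ψ.source)))
    (hG : IsPDOn n (ψ ∘ G ∘ e₂.symm) (e₂.target ∩ e₂.symm ⁻¹' (G ⁻¹' ψ.source)))
    {W : Set M} (hW : IsOpen W)
    (hlam : IsPLOn n n (e₁ ∘ F.symm ∘ G ∘ e₂.symm)
      (e₂.target ∩ e₂.symm ⁻¹' (W ∩ (F.symm ∘ G) ⁻¹' e₁.source)))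
    {R : Set (𝔼 n)} (hR : IsCompact R) (hRt : R ⊆ ψ.target)
    (hRF : ψ.symm '' R ⊆ F '' e₁.source) (hRG : ψ.symm '' R ⊆ G '' e₂.source)
    {Zc : Set M} (hZc : IsCompact Zc) (hZcR : Zc ⊆ ψ.symm '' interior R)
    (hZcW : ∀ p, G p ∈ Zc → p ∈ W) :
    Nonempty (TwoSheets ψ e₁ e₂ F G W R Zc) := by
  classical
  -- notation
  set lam : 𝔼 n → 𝔼 n := e₁ ∘ F.symm ∘ G ∘ e₂.symm with hlamdef
  set UK : Set (𝔼 n) := e₁.target ∩ e₁.symm ⁻¹' (F ⁻¹' ψ.source) with hUK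
  set UL : Set (𝔼 n) := e₂.target ∩ e₂.symm ⁻¹' (G ⁻¹' ψ.source) with hUL
  set V : Set (𝔼 n) := e₂.target ∩ e₂.symm ⁻¹' (W ∩ (F.symm ∘ G) ⁻¹' e₁.source) with hV
  have hUKo : IsOpen UK := by
    have h := e₁.symm.isOpen_inter_preimage (ψ.open_source.preimage F.continuous)
    rwa [e₁.symm_source] at h
  have hULo : IsOpen UL := by
    have h := e₂.symm.isOpen_inter_preimage (ψ.open_source.preimage G.continuous)
    rwa [e₂.symm_source] at h
  have hVo : IsOpen V := by
    have h := e₂.symm.isOpen_inter_preimage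
      (hW.inter (e₁.open_source.preimage (F.symm.continuous.comp G.continuous)))
    rwa [e₂.symm_source] at h
  -- basic point-set facts
  have hψR : ψ.symm '' R ⊆ ψ.source := fun q hq => by
    obtain ⟨z, hz, rfl⟩ := hq
    exact ψ.map_target (hRt hz)
  have hRcpt : IsCompact (ψ.symm '' R) := hR.image_of_continuousOn (ψ.continuousOn_symm.mono hRt)
  have hFsrc : ∀ q ∈ ψ.symm '' R, F.symm q ∈ e₁.source := fun q hq => by
    obtain ⟨p, hp, hpq⟩ := hRF hq
    rw [← hpq, Homeomorph.symm_apply_apply]; exact hp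
  have hGsrc : ∀ q ∈ ψ.symm '' R, G.symm q ∈ e₂.source := fun q hq => by
    obtain ⟨p, hp, hpq⟩ := hRG hq
    rw [← hpq, Homeomorph.symm_apply_apply]; exact hp
  -- the compact coordinate regions
  set CK : Set (𝔼 n) := e₁ '' (F ⁻¹' (ψ.symm '' R)) with hCK
  set CL : Set (𝔼 n) := e₂ '' (G ⁻¹' (ψ.symm '' R)) with hCL
  set CJ : Set (𝔼 n) := e₂ '' (G ⁻¹' Zc) with hCJ
  have hFpre : F ⁻¹' (ψ.symm '' R) ⊆ e₁.source := fun p hp => by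
    have := hFsrc (F p) hp; rwa [Homeomorph.symm_apply_apply] at this
  have hGpre : G ⁻¹' (ψ.symm '' R) ⊆ e₂.source := fun p hp => by
    have := hGsrc (G p) hp; rwa [Homeomorph.symm_apply_apply] at this
  have hZcR' : Zc ⊆ ψ.symm '' R := hZcR.trans (image_mono interior_subset)
  have hGpreZ : G ⁻¹' Zc ⊆ e₂.source := fun p hp => hGpre (hZcR' hp)
  have hCKc : IsCompact CK :=
    (F.isCompact_preimage.2 hRcpt).image_of_continuousOn (e₁.continuousOn.mono hFpre)
  have hCLc : IsCompact CL :=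
    (G.isCompact_preimage.2 hRcpt).image_of_continuousOn (e₂.continuousOn.mono hGpre)
  have hCJc : IsCompact CJ :=
    (G.isCompact_preimage.2 hZc).image_of_continuousOn (e₂.continuousOn.mono hGpreZ)
  have hCKU : CK ⊆ UK := by
    rintro _ ⟨p, hp, rfl⟩
    refine ⟨e₁.map_source (hFpre hp), ?_⟩
    show F (e₁.symm (e₁ p)) ∈ ψ.source
    rw [e₁.left_inv (hFpre hp)]; exact hψR hp
  have hCLU : CL ⊆ UL := by
    rintro _ ⟨p, hp, rfl⟩
    refine ⟨e₂.map_source (hGpre hp), ?_⟩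
    show G (e₂.symm (e₂ p)) ∈ ψ.source
    rw [e₂.left_inv (hGpre hp)]; exact hψR hp
  have hCJV : CJ ⊆ V := by
    rintro _ ⟨p, hp, rfl⟩
    refine ⟨e₂.map_source (hGpreZ hp), ?_⟩
    show e₂.symm (e₂ p) ∈ W ∩ (F.symm ∘ G) ⁻¹' e₁.source
    rw [e₂.left_inv (hGpreZ hp)]
    exact ⟨hZcW p hp, hFsrc (G p) (hZcR' hp)⟩
  have hCJCL : CJ ⊆ interior CL := by
    -- the open set `e₂ '' (G ⁻¹' (ψ.symm '' interior R))` lies between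
    have hopen : IsOpen (e₂ '' (G ⁻¹' (ψ.symm '' interior R))) := by
      refine e₂.isOpen_image_of_subset_source ?_ fun p hp => hGpre (image_mono interior_subset hp)
      exact (ψ.symm.isOpen_image_of_subset_source isOpen_interior
        (by rw [ψ.symm_source]; exact interior_subset.trans hRt)).preimage G.continuous
    refine (interior_maximal ?_ hopen) |> fun h => (image_mono (preimage_mono hZcR)).trans h
    exact image_mono (preimage_mono (image_mono interior_subset))
  -- `lam` on `V`: injective, open
  have hlaminj : InjOn lam V := injOn_comparison e₁ e₂ F G W
  have hlamopen : ∀ O ⊆ V, IsOpen O → IsOpen (lam '' O) := by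
    intro O hOV hO
    have h1 : IsOpen (e₂.symm '' O) :=
      e₂.symm.isOpen_image_of_subset_source hO (by rw [e₂.symm_source]; exact fun y hy => (hOV hy).1)
    have h2 : IsOpen (F.symm '' (G '' (e₂.symm '' O))) := F.symm.isOpenMap _ (G.isOpenMap _ h1)
    have h3 : F.symm '' (G '' (e₂.symm '' O)) ⊆ e₁.source := by
      rintro _ ⟨_, ⟨_, ⟨y, hy, rfl⟩, rfl⟩, rfl⟩
      exact (hOV hy).2.2
    have h4 : lam '' O = e₁ '' (F.symm '' (G '' (e₂.symm '' O))) := by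
      rw [hlamdef, Set.image_comp, Set.image_comp, Set.image_comp]
    rw [h4]
    exact e₁.isOpen_image_of_subset_source h2 h3
  have hlamcont : ContinuousOn lam V := by
    refine e₁.continuousOn.comp ((F.symm.continuous.comp G.continuous).comp_continuousOn
      (e₂.continuousOn_symm.mono fun y hy => hy.1)) fun y hy => hy.2.2
  -- `lam` maps `CL` into `CK` (pointwise form)
  have hlamCK : ∀ y ∈ e₂.target, G (e₂.symm y) ∈ ψ.symm '' R → lam y ∈ CK := by
    intro y hy hGy
    refine ⟨F.symm (G (e₂.symm y)), ?_, rfl⟩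
    show F (F.symm (G (e₂.symm y))) ∈ ψ.symm '' R
    rw [Homeomorph.apply_symm_apply]; exact hGy
  -- the margin `r`
  obtain ⟨r₀, hr₀, hr₀sub⟩ := hCJc.exists_cthickening_subset_open (isOpen_interior.inter hVo)
    (subset_inter hCJCL hCJV)
  set r : ℝ := r₀ / 2 with hr
  have hr0 : 0 < r := by positivity
  have h2r : cthickening (2 * r) CJ ⊆ interior CL ∩ V := by
    rw [hr, mul_div_cancel₀ _ two_ne_zero]; exact hr₀sub
  -- the second sheet, first version
  obtain ⟨L₁, hL₁fin, hCL₁, hL₁U, hL₁pd, hL₁aff, hL₁mesh, -, -⟩ :=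
    exists_complex_adapted hULo hG hlam hCLc hCLU hr0 (h2r.trans inter_subset_right) hr0 ∅
      (fun s hs => (Finset.notMem_empty s hs).elim)
  -- `J₁`
  set J₁ : Set (Finset (𝔼 n)) := {t | t ∈ L₁.faces ∧ ∃ u ∈ L₁.faces, t ⊆ u ∧
    (convexHull ℝ (u : Set (𝔼 n)) ∩ cthickening r CJ).Nonempty} with hJ₁
  have hJ₁sub : J₁ ⊆ L₁.faces := fun t ht => ht.1
  have hJ₁down : ∀ s ∈ J₁, ∀ t ⊆ s, t.Nonempty → t ∈ J₁ := fun s hs t hts hne =>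
    ⟨L₁.down_closed hs.1 hts hne, by
      obtain ⟨u, hu, hsu, hune⟩ := hs.2
      exact ⟨u, hu, hts.trans hsu, hune⟩⟩
  have hmeet2r : ∀ u ∈ L₁.faces, (convexHull ℝ (u : Set (𝔼 n)) ∩ cthickening r CJ).Nonempty →
      convexHull ℝ (u : Set (𝔼 n)) ⊆ cthickening (2 * r) CJ := by
    intro u hu hne y hy
    obtain ⟨y₀, hy₀u, hy₀C⟩ := hne
    have h1 : y ∈ cthickening r (cthickening r CJ) :=
      mem_cthickening_of_dist_le y y₀ r _ hy₀C (hL₁mesh u hu y hy y₀ hy₀u)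
    rw [two_mul]
    exact cthickening_cthickening_subset hr0.le hr0.le _ h1
  have hJ₁hull : ∀ t ∈ J₁, convexHull ℝ (t : Set (𝔼 n)) ⊆ cthickening (2 * r) CJ := by
    intro t ht
    obtain ⟨u, hu, htu, hune⟩ := ht.2
    exact (convexHull_mono (by exact_mod_cast htu)).trans (hmeet2r u hu hune)
  have hJ₁aff : ∀ t ∈ J₁, ∃ A : 𝔼 n →ᵃ[ℝ] 𝔼 n, EqOn lam A (convexHull ℝ (t : Set (𝔼 n))) := by
    intro t ht
    obtain ⟨u, hu, htu, hune⟩ := ht.2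
    exact ((hL₁aff u hu hune).1.anti (convexHull_mono (by exact_mod_cast htu))).out
  set Dom : Set (𝔼 n) := ⋃ u ∈ J₁, convexHull ℝ (u : Set (𝔼 n)) with hDom
  have hDomV : Dom ⊆ V := fun y hy => by
    obtain ⟨u, hu, hyu⟩ := mem_iUnion₂.1 hy
    exact (h2r (hJ₁hull u hu hyu)).2
  have hinjDom : InjOn lam Dom := hlaminj.mono hDomV
  -- the transported complex `Q`
  set LJ : Geometry.SimplicialComplex ℝ (𝔼 n) := subcomplexOf L₁ J₁ hJ₁sub hJ₁down with hLJ
  have hLJspace : LJ.space = Dom := rfl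
  obtain ⟨Q, hQfaces, hQhull⟩ := exists_simplicialComplex_image LJ lam hJ₁aff
    (by rw [hLJspace]; exact hinjDom)
  have hQfin : Q.faces.Finite := by
    have : Q.faces = (fun t => t.image lam) '' J₁ := by
      ext q; rw [hQfaces q, Set.mem_image]; rfl
    rw [this]; exact (hL₁fin.subset hJ₁sub).image _
  have hQspace : Q.space = lam '' Dom := by
    refine Subset.antisymm (fun z hz => ?_) ?_
    · obtain ⟨q, hq, hzq⟩ := Geometry.SimplicialComplex.mem_space_iff.1 hz
      obtain ⟨u, hu, rfl⟩ := (hQfaces q).1 hq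
      rw [hQhull u hu] at hzq
      exact image_mono (fun y hy => mem_iUnion₂.2 ⟨u, hu, hy⟩) hzq
    · rintro _ ⟨y, hy, rfl⟩
      obtain ⟨u, hu, hyu⟩ := mem_iUnion₂.1 hy
      refine Geometry.SimplicialComplex.mem_space_iff.2 ⟨u.image lam, (hQfaces _).2 ⟨u, hu, rfl⟩, ?_⟩
      rw [hQhull u hu]; exact ⟨y, hyu, rfl⟩
  -- `Dom` contains `cthickening r CJ`, so `lam '' thickening r CJ ⊆ Q.space`
  have hthickDom : cthickening r CJ ⊆ Dom := by
    intro y hy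
    have hyCL : y ∈ CL := interior_subset
      ((h2r ((cthickening_mono (by linarith) CJ) hy)).1)
    have hyL : y ∈ L₁.space := interior_subset (hCL₁ hyCL)
    obtain ⟨u, hu, hyu⟩ := Geometry.SimplicialComplex.mem_space_iff.1 hyL
    exact mem_iUnion₂.2 ⟨u, ⟨hu, u, hu, Subset.rfl, ⟨y, hyu, hy⟩⟩, hyu⟩
  -- the margin `ρ` for the first sheet
  set CKZ : Set (𝔼 n) := e₁ '' (F ⁻¹' Zc) with hCKZ
  have hCKZlam : CKZ ⊆ lam '' CJ := by
    rintro _ ⟨p, hp, rfl⟩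
    refine ⟨e₂ (G.symm (F p)), ⟨G.symm (F p), by simpa using hp, rfl⟩, ?_⟩
    show e₁ (F.symm (G (e₂.symm (e₂ (G.symm (F p)))))) = e₁ p
    rw [e₂.left_inv (hGpreZ (by simpa using hp)), Homeomorph.apply_symm_apply,
      Homeomorph.symm_apply_apply]
  have hFpreZ : F ⁻¹' Zc ⊆ e₁.source := fun p hp => hFpre (hZcR' hp)
  have hCKZc : IsCompact CKZ :=
    (F.isCompact_preimage.2 hZc).image_of_continuousOn (e₁.continuousOn.mono hFpreZ)
  have hthickV : thickening r CJ ⊆ V := fun y hy =>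
    (h2r ((cthickening_mono (by linarith) CJ) (thickening_subset_cthickening r CJ hy))).2
  have hO₃ : IsOpen (lam '' thickening r CJ) := hlamopen _ hthickV isOpen_thickening
  have hCKZO₃ : CKZ ⊆ lam '' thickening r CJ :=
    hCKZlam.trans (image_mono (self_subset_thickening hr0 CJ))
  obtain ⟨ρ, hρ, hρsub⟩ := hCKZc.exists_cthickening_subset_open hO₃ hCKZO₃
  have hO₃Q : lam '' thickening r CJ ⊆ Q.space := by
    rw [hQspace]
    exact image_mono ((thickening_subset_cthickening r CJ).trans hthickDom)
  -- the first sheet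
  have hQind : ∀ q ∈ hQfin.toFinset, AffineIndependent ℝ ((↑) : q → 𝔼 n) := fun q hq =>
    Q.indep (hQfin.mem_toFinset.1 hq)
  obtain ⟨K, hKfin, hCKK, hKU, hKpd, -, hKmesh, hKvert, hKcovQ⟩ :=
    exists_complex_adapted (μ := lam) (V := ∅) (CJ := ∅) hUKo hF (fun a ha => ha.elim) hCKc hCKU
      one_pos (by rw [cthickening_empty]) hρ hQfin.toFinset hQind
  -- cells are covered by `K` simplexwise
  have hcellCK : ∀ u ∈ J₁, lam '' convexHull ℝ (u : Set (𝔼 n)) ⊆ CK := by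
    rintro u hu _ ⟨y, hy, rfl⟩
    have hy2 := h2r (hJ₁hull u hu hy)
    have hyCL : y ∈ CL := interior_subset hy2.1
    obtain ⟨p, hp, rfl⟩ := hyCL
    refine hlamCK _ (e₂.map_source (hGpre hp)) ?_
    rw [e₂.left_inv (hGpre hp)]; exact hp
  have hcov : ∀ u ∈ J₁, ∀ z ∈ lam '' convexHull ℝ (u : Set (𝔼 n)), ∃ t ∈ K.faces,
      z ∈ convexHull ℝ (t : Set (𝔼 n)) ∧
        convexHull ℝ (t : Set (𝔼 n)) ⊆ lam '' convexHull ℝ (u : Set (𝔼 n)) := by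
    intro u hu z hz
    have hq : u.image lam ∈ hQfin.toFinset := hQfin.mem_toFinset.2 ((hQfaces _).2 ⟨u, hu, rfl⟩)
    rw [← hQhull u hu] at hz ⊢
    refine hKcovQ _ hq ?_ z hz
    rw [hQhull u hu]
    exact (hcellCK u hu).trans (hCKK.trans interior_subset)
  -- pull back and extend
  obtain ⟨L₂, J₂, hL₂fin, hL₂space, hL₂ref, -, hJ₂L₂, hJ₂down, hJ₂char, hJ₂prop, hJ₂surj⟩ :=
    exists_pullback_extension L₁ hL₁fin hJ₁sub hJ₁down lam hinjDom hJ₁aff K hKfin hcov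
  -- purify
  have hfr : Module.finrank ℝ (𝔼 n) = n := finrank_euclideanSpace_fin
  obtain ⟨K', hK'K, hK'int, hK'sp, hK'pure, hK'crit⟩ := exists_pure_subcomplex' K hKfin
  obtain ⟨L', hL'L, hL'int, hL'sp, hL'pure, hL'crit⟩ := exists_pure_subcomplex' L₂ hL₂fin
  rw [hfr] at hK'pure hL'pure
  -- the shared simplices
  set Sh : Set (Finset (𝔼 n)) := {t | t ∈ J₂ ∧ t ∈ L'.faces ∧ t.image lam ∈ K'.faces} with hSh
  -- interiors
  have hintK : lam '' cthickening (2 * r) CJ ⊆ interior K.space := by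
    rintro _ ⟨y, hy, rfl⟩
    have hy2 := h2r hy
    obtain ⟨p, hp, rfl⟩ := (interior_subset hy2.1 : y ∈ CL)
    refine hCKK (hlamCK _ (e₂.map_source (hGpre hp)) ?_)
    rw [e₂.left_inv (hGpre hp)]; exact hp
  have hintL : cthickening (2 * r) CJ ⊆ interior L₂.space := by
    rw [hL₂space]
    intro y hy
    have h := interior_mono hCL₁ (h2r hy).1
    rwa [interior_interior] at h
  refine ⟨{
    K := K'
    L := L'
    Sh := Sh
    hKfin := hKfin.subset hK'K
    hLfin := hL₂fin.subset hL'L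
    hKpure := hK'pure
    hLpure := hL'pure
    hKU := hK'sp.trans hKU
    hLU := hL'sp.trans (by rw [hL₂space]; exact hL₁U)
    hKcov := ?_
    hLcov := ?_
    hKmodel := fun s hs => hKpd s (hK'K hs)
    hLmodel := fun t ht => ?_
    hSh := fun t ht => ht.2.1
    hShdown := fun t ht t' htt' hne => ?_
    hShV := fun t ht => ?_
    hShaff := fun t ht => ⟨(hJ₂prop t ht.1).2.1⟩
    hShimg := fun t ht => ht.2.2
    hShhull := fun t ht => (hJ₂prop t ht.1).2.2.2
    hLshare := fun t ht hy => ?_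
    hKshare := fun s hs hx => ?_ }⟩
  · -- coverage by the first sheet
    have hopen : IsOpen (F '' (e₁.symm '' interior K.space)) :=
      F.isOpenMap _ (e₁.symm.isOpen_image_of_subset_source isOpen_interior
        (by rw [e₁.symm_source]; exact interior_subset.trans fun x hx => (hKU hx).1))
    have hsub1 : ψ.symm '' R ⊆ F '' (e₁.symm '' interior K.space) := by
      intro q hq
      have h1 : F (F.symm q) ∈ ψ.symm '' R := by rw [Homeomorph.apply_symm_apply]; exact hq
      refine ⟨e₁.symm (e₁ (F.symm q)), ⟨e₁ (F.symm q), hCKK ⟨F.symm q, h1, rfl⟩, rfl⟩, ?_⟩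
      show F (e₁.symm (e₁ (F.symm q))) = q
      rw [e₁.left_inv (hFsrc q hq), Homeomorph.apply_symm_apply]
    have hsub2 : F '' (e₁.symm '' interior K.space) ⊆ F '' (e₁.symm '' K'.space) :=
      image_mono (image_mono hK'int)
    exact hsub1.trans (interior_maximal hsub2 hopen)
  · -- coverage by the second sheet
    have hsub : interior L₁.space ⊆ L'.space := by rw [← hL₂space]; exact hL'int
    have hopen : IsOpen (G '' (e₂.symm '' interior L₁.space)) :=
      G.isOpenMap _ (e₂.symm.isOpen_image_of_subset_source isOpen_interior
        (by rw [e₂.symm_source]; exact interior_subset.trans fun x hx => (hL₁U hx).1))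
    have hsub1 : ψ.symm '' R ⊆ G '' (e₂.symm '' interior L₁.space) := by
      intro q hq
      have h1 : G (G.symm q) ∈ ψ.symm '' R := by rw [Homeomorph.apply_symm_apply]; exact hq
      refine ⟨e₂.symm (e₂ (G.symm q)), ⟨e₂ (G.symm q), hCL₁ ⟨G.symm q, h1, rfl⟩, rfl⟩, ?_⟩
      show G (e₂.symm (e₂ (G.symm q))) = q
      rw [e₂.left_inv (hGsrc q hq), Homeomorph.apply_symm_apply]
    have hsub2 : G '' (e₂.symm '' interior L₁.space) ⊆ G '' (e₂.symm '' L'.space) :=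
      image_mono (image_mono hsub)
    exact hsub1.trans (interior_maximal hsub2 hopen)
  · -- models on the second sheet
    obtain ⟨s, hs, hts⟩ := hL₂ref t (hL'L ht)
    exact (hL₁pd s hs).anti hts
  · -- `Sh` is down-closed
    refine ⟨hJ₂down t ht.1 t' htt' hne, L'.down_closed ht.2.1 htt' hne,
      K'.down_closed ht.2.2 (Finset.image_subset_image htt') (hne.image _)⟩
  · -- shared closed simplices lie in `V`
    obtain ⟨⟨u, hu, htu⟩, -⟩ := hJ₂prop t ht.1
    exact htu.trans fun y hy => (h2r (hJ₁hull u hu hy)).2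
  · -- simplices of `L` meeting `Zc` are shared
    obtain ⟨y, hyt, hyZ⟩ := hy
    have htL₂ : t ∈ L₂.faces := hL'L ht
    obtain ⟨s, hs, hts⟩ := hL₂ref t htL₂
    have hyUL : y ∈ UL := by
      rw [← hL₂space] at hL₁U
      exact hL₁U (Geometry.SimplicialComplex.convexHull_subset_space htL₂ hyt)
    have hyCJ : y ∈ CJ := by
      refine ⟨e₂.symm y, hyZ, ?_⟩
      exact e₂.right_inv hyUL.1
    have hsJ₁ : s ∈ J₁ := ⟨hs, s, hs, Subset.rfl, ⟨y, hts hyt, self_subset_cthickening CJ hyCJ⟩⟩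
    have htJ₂ : t ∈ J₂ := hJ₂char t htL₂ ⟨s, hsJ₁, hts⟩
    refine ⟨htJ₂, ht, hK'crit _ (hJ₂prop t htJ₂).2.2.1 ?_⟩
    rw [(hJ₂prop t htJ₂).2.2.2]
    exact ((image_mono (hts.trans (hJ₁hull s hsJ₁))).trans hintK).trans subset_closure
  · -- simplices of `K` meeting `Zc` are shared
    obtain ⟨x, hxs, hxZ⟩ := hx
    have hsK : s ∈ K.faces := hK'K hs
    have hxUK : x ∈ UK := hKU (Geometry.SimplicialComplex.convexHull_subset_space hsK hxs)
    have hxCKZ : x ∈ CKZ := ⟨e₁.symm x, hxZ, e₁.right_inv hxUK.1⟩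
    -- the closed simplex lies in `Q.space`
    have hsQ : convexHull ℝ (s : Set (𝔼 n)) ⊆ Q.space := fun y hy =>
      hO₃Q (hρsub (mem_cthickening_of_dist_le y x ρ CKZ hxCKZ (hKmesh s hsK y hy x hxs)))
    -- hence in one cell
    obtain ⟨v, hvs, hvQ⟩ := hKvert s hsK
    have hvQsp : v ∈ Q.space := hsQ (subset_convexHull ℝ _ hvs)
    obtain ⟨q, hq, hvq⟩ := Geometry.SimplicialComplex.mem_space_iff.1 hvQsp
    obtain ⟨u, hu, rfl⟩ := (hQfaces q).1 hq
    have hsu : convexHull ℝ (s : Set (𝔼 n)) ⊆ lam '' convexHull ℝ (u : Set (𝔼 n)) := by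
      rw [← hQhull u hu]; exact hvQ _ (hQfin.mem_toFinset.2 hq) hvq
    obtain ⟨t, htJ₂, hts⟩ := hJ₂surj s hsK ⟨u, hu, hsu⟩
    refine ⟨t, ⟨htJ₂, hL'crit t (hJ₂L₂ htJ₂) ?_, by rw [hts]; exact hs⟩, hts⟩
    obtain ⟨⟨u', hu', htu'⟩, -⟩ := hJ₂prop t htJ₂
    exact (htu'.trans ((hJ₁hull u' hu').trans hintL)).trans subset_closure

end TwoSheets

end Literature.Topology.FourManifolds
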